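import Summits.MatrixMultiplication.OmegaCensus.STPPVosperTilingLaw

/-!
# ω-census (abelian STPP census): the two-stage exact-cover search on arbitrary Y- and Z-point lists — definitions, candidate lists, block data (kernel)

HONEST FRAMING (pub-omega census; verbatim): lottery ticket; floor = certified bounds/negative ranges.
Census STRUCTURE (seat pub-omega-stpp-2 gen 25, 2026-08-28), family (b2).  Tools for EXCLUDING candidate STPP block patterns of `ℤ/pℤ` by theorem;
nothing here is progress on `ω`.

`STPPVosperTilingTools.lean` (stpp-1 g30) decides, for an N18-TIGHT block, whether the difference sets `C_k − B_k`, `C_k − A_k` of the OTHER blocks can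
partition the two Vosper progressions `Y°` (a point list) and `Z° = [0, z)` (`existsCover`).  At a SLACK-ONE block the normalised sets
`Y° = ⋃_{k≠i}(C_k − B_k)`, `Z° = ⋃_{k≠i}(C_k − A_k)` are still rigid but of other shapes (a progression with a term removed or a point added, two runs), and
the one-pass search is too slow for the kernel on two- and three-block complements.  This file defines a faster, more general search with the same
meaning (soundness: `STPPVosperCoverSearchSound.lean`; extraction from an STPP family: `STPPVosperCoverExtract.lean`):

* §1 `coverSearch p YL ZL sizes` — TWO-STAGE search.  Stage 1 (`coverY`) places, block by block, the Y-data `(C, B′)` (`0 ∈ B = 0 :: B′`,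
  `C − B` inside the REMAINING Y-points, distinct differences, and the normalisation `minInC`: some element of `C` is `≤` every difference — w.l.o.g. by
  the choice of the translation of the block) and removes `C − B` from the remaining Y-points; when all blocks are placed the Y-points must be exhausted,
  and stage 2 (`coverZ`) chooses `A` for every placed block inside the remaining Z-points (`C − A ⊆` remaining, distinct `C − A` and `A − B`) until the
  Z-points are exhausted.  Candidate shifts are generated from the first element of `C` (`shiftCands`), and a block is only recursed on if it has at least
  `a` Z-candidates.  Both point lists are de-duplicated first, so soundness needs no `Nodup` hypothesis.
* §2 membership facts; §3 the lists `Cl, Bl, Al` realising a genuine block inside the candidate lists (`exists_yCands_of_block`, `exists_aList_of_block`);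
* §4 value lemmas for progression points (`(u·(t•d)).val = ((u d).val·t) mod p`, index descriptions of `Y°`, `Z°`).

Python mirror with the same enumeration: HOME `pub-omega-stpp-2-g25/code/pilot/mirror3.py` (kernel: ≈ 35–50 s per search on the ℤ₅₉/ℤ₆₁ targets).

References: A. G. Vosper, J. London Math. Soc. 31 (1956); H. Cohn, R. Kleinberg, B. Szegedy, C. Umans, FOCS 2005 (arXiv:math/0511460), Def. 5.1.
-/

open Finset
open scoped Pointwise

namespace Summit.MatrixMultiplication.OmegaCensus.CubeNB

open Literature.Computability.AlgebraicComplexity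
open Literature.Combinatorics.Additive
open Summit.MatrixMultiplication.OmegaCensus.STPPKneser

/-! ## §1 The two-stage search -/

section Search

/-- Candidate shifts `x` for a block with C-list `c₀ :: C'` inside the point list `R`: `x = c₀ − y` for some `y ∈ R` with `c − x ∈ R` for the other
`c` (residues `mod p`), de-duplicated. [folklore] -/
def shiftCands (p : ℕ) : List ℕ → List ℕ → List ℕ
  | [], _ => []
  | c₀ :: C', R => ((R.map fun y => (c₀ + p - y) % p).filter fun x => C'.all fun c => decide ((c + p - x) % p ∈ R)).dedup

/-- Normalisation test: some element of `C` is `≤` every listed difference. [folklore] -/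
def minInC (C D : List ℕ) : Bool := C.any fun c => D.all fun d => decide (c ≤ d)

/-- Stage-1 candidates of one block inside the remaining Y-points `RY`: pairs `(C, B′)` with `C` a `c`-sublist of `RY`, `B′` a `(b−1)`-sublist of the
non-zero shifts, `C − (0 :: B′)` duplicate-free and normalised. [folklore] -/
def yCands (p : ℕ) (RY : List ℕ) (b c : ℕ) : List (List ℕ × List ℕ) :=
  (RY.sublistsLen c).flatMap fun C =>
    (((shiftCands p C RY).filter fun x => x != 0).sublistsLen (b - 1)).filterMap fun B' =>
      if (diffList p C (0 :: B')).Nodup && minInC C (diffList p C (0 :: B')) then some (C, B') else none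

/-- Stage 2: choose `A` (an `a`-sublist of the shifts into the remaining Z-points) for every placed block `(a, C, B′)`, with `C − A` and `A − (0 :: B′)`
duplicate-free, removing `C − A` from the remaining Z-points; succeed iff they are exhausted. [folklore] -/
def coverZ (p : ℕ) : List ℕ → List (ℕ × List ℕ × List ℕ) → Bool
  | RZ, [] => RZ.isEmpty
  | RZ, (a, C, B') :: rest =>
    ((shiftCands p C RZ).sublistsLen a).any fun A =>
      (diffList p C A).Nodup && (diffList p A (0 :: B')).Nodup &&
        coverZ p (RZ.filter fun t => !(decide (t ∈ diffList p C A))) rest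

/-- Stage 1: place the blocks `(a, b, c)` one by one inside the remaining Y-points (only if at least `a` Z-shifts exist), then run stage 2.
[folklore] -/
def coverY (p : ℕ) (RZ : List ℕ) : List ℕ → List (ℕ × ℕ × ℕ) → List (ℕ × List ℕ × List ℕ) → Bool
  | RY, [], chosen => RY.isEmpty && coverZ p RZ chosen
  | RY, (a, b, c) :: rest, chosen =>
    (yCands p RY b c).any fun CB =>
      decide (a ≤ (shiftCands p CB.1 RZ).length) &&
        coverY p RZ (RY.filter fun y => !(decide (y ∈ diffList p CB.1 (0 :: CB.2)))) rest ((a, CB.1, CB.2) :: chosen)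

/-- **The two-stage exact-cover search** on de-duplicated point lists. [folklore] -/
def coverSearch (p : ℕ) (YL ZL : List ℕ) (sizes : List (ℕ × ℕ × ℕ)) : Bool := coverY p ZL.dedup YL.dedup sizes []

end Search

/-! ## §2 Small facts about the candidate lists -/

section Facts

/-- `shiftCands` is duplicate-free. [folklore] -/
theorem shiftCands_nodup (p : ℕ) (C R : List ℕ) : (shiftCands p C R).Nodup := by
  cases C with
  | nil => exact List.nodup_nil
  | cons c₀ C' => exact List.nodup_dedup _

/-- Membership in `shiftCands`. [folklore] -/
theorem mem_shiftCands_cons {p c₀ x : ℕ} {C' R : List ℕ} :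
    x ∈ shiftCands p (c₀ :: C') R ↔ (∃ y ∈ R, (c₀ + p - y) % p = x) ∧ ∀ c ∈ C', (c + p - x) % p ∈ R := by
  simp only [shiftCands, List.mem_dedup, List.mem_filter, List.mem_map, List.all_eq_true, decide_eq_true_eq]

/-- The shift recovered from a difference: `(c + p − ((c + p − x) mod p)) mod p = x` for `c, x < p`. [folklore] -/
theorem sub_mod_sub_mod_eq {p c x : ℕ} (hc : c < p) (hx : x < p) : (c + p - (c + p - x) % p) % p = x := by
  rcases Nat.lt_or_ge c x with h | h
  · rw [Nat.mod_eq_of_lt (by omega : c + p - x < p)]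
    have h2 : c + p - (c + p - x) = x := by omega
    rw [h2, Nat.mod_eq_of_lt hx]
  · have h1 : c + p - x = (c - x) + p := by omega
    rw [h1, Nat.add_mod_right, Nat.mod_eq_of_lt (by omega : c - x < p)]
    have h2 : c + p - (c - x) = x + p := by omega
    rw [h2, Nat.add_mod_right, Nat.mod_eq_of_lt hx]

/-- Membership in `yCands` (the witnesses spelled out). [folklore] -/
theorem mem_yCands {p : ℕ} {RY : List ℕ} {b c : ℕ} {C B' : List ℕ} (hC : C ∈ RY.sublistsLen c)
    (hB : B' ∈ (((shiftCands p C RY).filter fun x => x != 0).sublistsLen (b - 1)))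
    (h1 : (diffList p C (0 :: B')).Nodup) (h2 : minInC C (diffList p C (0 :: B')) = true) : (C, B') ∈ yCands p RY b c := by
  rw [yCands, List.mem_flatMap]
  refine ⟨C, hC, ?_⟩
  rw [List.mem_filterMap]
  refine ⟨B', hB, ?_⟩
  simp [h1, h2]

/-- Meaning of `minInC`. [folklore] -/
theorem minInC_eq_true {C D : List ℕ} : minInC C D = true ↔ ∃ c ∈ C, ∀ d ∈ D, c ≤ d := by
  simp only [minInC, List.any_eq_true, List.all_eq_true, decide_eq_true_eq]

end Facts

/-! ## §3 The lists realising a block -/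

section Realise

variable {ι : Type*}

/-- **Stage-1 data of a real block.**  Inside remaining Y-points `RY` (duplicate-free) a block `k` with value sets `Bv k, Cv k ⊆ [0,p)`, `0 ∈ Bv k`,
`Cv k ≠ ∅`, all `(c − x) mod p ∈ RY`, injective difference map and the minimum property (some `c₀ ∈ Cv k` is `≤` every difference) yields lists `Cl`, `Bl`
with the right members and `(Cl, Bl) ∈ yCands p RY #(Bv k) #(Cv k)`. [folklore] -/
theorem exists_yCands_of_block {p : ℕ} {RY : List ℕ} (hRY : RY.Nodup) (Bv Cv : Finset ℕ)
    (hBp : ∀ x ∈ Bv, x < p) (hCp : ∀ x ∈ Cv, x < p) (hB0 : 0 ∈ Bv) (hCne : Cv.Nonempty)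
    (hY : ∀ c ∈ Cv, ∀ x ∈ Bv, (c + p - x) % p ∈ RY)
    (hinjY : ∀ c ∈ Cv, ∀ c' ∈ Cv, ∀ x ∈ Bv, ∀ x' ∈ Bv, (c + p - x) % p = (c' + p - x') % p → c = c' ∧ x = x')
    (hmin : ∃ c₀ ∈ Cv, ∀ c ∈ Cv, ∀ x ∈ Bv, c₀ ≤ (c + p - x) % p) :
    ∃ Cl Bl : List ℕ, Cl.Nodup ∧ (∀ x, x ∈ Cl ↔ x ∈ Cv) ∧ (0 :: Bl).Nodup ∧ (∀ x, x ∈ (0 :: Bl) ↔ x ∈ Bv) ∧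
      (Cl, Bl) ∈ yCands p RY #Bv #Cv := by
  have hCsub : ∀ x ∈ Cv, x ∈ RY := by
    intro x hx
    have h := hY x hx 0 hB0
    rwa [Nat.sub_zero, Nat.add_mod_right, Nat.mod_eq_of_lt (hCp x hx)] at h
  set Cl := RY.filter (fun x => decide (x ∈ Cv)) with hCl
  have hClmem : ∀ x, x ∈ Cl ↔ x ∈ Cv := by
    intro x; rw [hCl, List.mem_filter, decide_eq_true_eq]; exact ⟨fun h => h.2, fun h => ⟨hCsub x h, h⟩⟩
  have hClnd : Cl.Nodup := hRY.filter _
  have hCllen : Cl.length = #Cv := by rw [hCl, length_filter_mem_of_subset hRY hCsub]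
  -- Cl is non-empty: split off its head
  obtain ⟨c₀, C', hClE⟩ : ∃ c₀ C', Cl = c₀ :: C' := by
    cases hCl' : Cl with
    | nil => exfalso; obtain ⟨x, hx⟩ := hCne; have := (hClmem x).2 hx; rw [hCl'] at this; simp at this
    | cons c₀ C' => exact ⟨c₀, C', rfl⟩
  have hc₀ : c₀ ∈ Cv := (hClmem c₀).1 (by rw [hClE]; simp)
  have hC' : ∀ c ∈ C', c ∈ Cv := fun c hc => (hClmem c).1 (by rw [hClE]; simp [hc])
  set candB := (shiftCands p Cl RY).filter (fun x => x != 0) with hcandB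
  set Bl := candB.filter (fun x => decide (x ∈ Bv.erase 0)) with hBl
  have hBsub : ∀ x ∈ Bv.erase 0, x ∈ candB := by
    intro x hx
    rw [Finset.mem_erase] at hx
    rw [hcandB, List.mem_filter, hClE, mem_shiftCands_cons]
    refine ⟨⟨⟨(c₀ + p - x) % p, hY c₀ hc₀ x hx.2, sub_mod_sub_mod_eq (hCp c₀ hc₀) (hBp x hx.2)⟩,
      fun c hc => hY c (hC' c hc) x hx.2⟩, by simpa using hx.1⟩
  have hcandBnd : candB.Nodup := (shiftCands_nodup p Cl RY).filter _
  have hBlmem : ∀ x, x ∈ Bl ↔ x ∈ Bv.erase 0 := by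
    intro x; rw [hBl, List.mem_filter, decide_eq_true_eq]; exact ⟨fun h => h.2, fun h => ⟨hBsub x h, h⟩⟩
  have hBlnd : Bl.Nodup := hcandBnd.filter _
  have hBllen : Bl.length = #Bv - 1 := by
    rw [hBl, length_filter_mem_of_subset hcandBnd hBsub, Finset.card_erase_of_mem hB0]
  have hB0l : ∀ x, x ∈ (0 :: Bl) ↔ x ∈ Bv := by
    intro x; rw [List.mem_cons, hBlmem, Finset.mem_erase]
    constructor
    · rintro (rfl | ⟨-, h⟩); exacts [hB0, h]
    · intro h; by_cases h0 : x = 0; exacts [Or.inl h0, Or.inr ⟨h0, h⟩]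
  have hB0nd : (0 :: Bl).Nodup := by
    rw [List.nodup_cons]; refine ⟨fun h => ?_, hBlnd⟩
    have := (hBlmem 0).1 h; simp at this
  have hn1 : (diffList p Cl (0 :: Bl)).Nodup := nodup_diffList hClnd hB0nd fun c₁ hc₁ c₂ hc₂ x₁ hx₁ x₂ hx₂ h =>
    hinjY c₁ ((hClmem _).1 hc₁) c₂ ((hClmem _).1 hc₂) x₁ ((hB0l _).1 hx₁) x₂ ((hB0l _).1 hx₂) h
  have hmin' : minInC Cl (diffList p Cl (0 :: Bl)) = true := by
    rw [minInC_eq_true]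
    obtain ⟨m₀, hm₀, hmin⟩ := hmin
    refine ⟨m₀, (hClmem _).2 hm₀, fun d hd => ?_⟩
    obtain ⟨c, hc, x, hx, rfl⟩ := mem_diffList.1 hd
    exact hmin c ((hClmem _).1 hc) x ((hB0l _).1 hx)
  refine ⟨Cl, Bl, hClnd, hClmem, hB0nd, hB0l, ?_⟩
  exact mem_yCands (List.mem_sublistsLen.2 ⟨by rw [hCl]; exact List.filter_sublist, hCllen⟩)
    (List.mem_sublistsLen.2 ⟨by rw [hBl]; exact List.filter_sublist, hBllen⟩) hn1 hmin'

/-- **Stage-2 data of a real block.**  For lists `Cl` (members = `Cv`, non-empty) and `0 :: Bl` (members = `Bv`) and remaining Z-points `RZ` containing every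
`(c − x) mod p` (`c ∈ Cv`, `x ∈ Av`), with injective difference maps `C − A`, `A − B`: a list `Al` with members `Av`,
`Al ∈ (shiftCands p Cl RZ).sublistsLen #Av`, and the two difference lists duplicate-free. [folklore] -/
theorem exists_aList_of_block {p : ℕ} {RZ : List ℕ} (Av Bv Cv : Finset ℕ) {Cl Bl : List ℕ}
    (hClnd : Cl.Nodup) (hClmem : ∀ x, x ∈ Cl ↔ x ∈ Cv) (hB0nd : (0 :: Bl).Nodup) (hB0l : ∀ x, x ∈ (0 :: Bl) ↔ x ∈ Bv)
    (hAp : ∀ x ∈ Av, x < p) (hCp : ∀ x ∈ Cv, x < p) (hCne : Cv.Nonempty)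
    (hZ : ∀ c ∈ Cv, ∀ x ∈ Av, (c + p - x) % p ∈ RZ)
    (hinjZ : ∀ c ∈ Cv, ∀ c' ∈ Cv, ∀ x ∈ Av, ∀ x' ∈ Av, (c + p - x) % p = (c' + p - x') % p → c = c' ∧ x = x')
    (hinjX : ∀ c ∈ Av, ∀ c' ∈ Av, ∀ x ∈ Bv, ∀ x' ∈ Bv, (c + p - x) % p = (c' + p - x') % p → c = c' ∧ x = x') :
    ∃ Al : List ℕ, Al.Nodup ∧ (∀ x, x ∈ Al ↔ x ∈ Av) ∧ Al ∈ (shiftCands p Cl RZ).sublistsLen #Av ∧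
      (diffList p Cl Al).Nodup ∧ (diffList p Al (0 :: Bl)).Nodup := by
  obtain ⟨c₀, C', hClE⟩ : ∃ c₀ C', Cl = c₀ :: C' := by
    cases hCl' : Cl with
    | nil => exfalso; obtain ⟨x, hx⟩ := hCne; have := (hClmem x).2 hx; rw [hCl'] at this; simp at this
    | cons c₀ C' => exact ⟨c₀, C', rfl⟩
  have hc₀ : c₀ ∈ Cv := (hClmem c₀).1 (by rw [hClE]; simp)
  have hC' : ∀ c ∈ C', c ∈ Cv := fun c hc => (hClmem c).1 (by rw [hClE]; simp [hc])
  set candA := shiftCands p Cl RZ with hcandA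
  set Al := candA.filter (fun x => decide (x ∈ Av)) with hAl
  have hAsub : ∀ x ∈ Av, x ∈ candA := by
    intro x hx
    rw [hcandA, hClE, mem_shiftCands_cons]
    exact ⟨⟨(c₀ + p - x) % p, hZ c₀ hc₀ x hx, sub_mod_sub_mod_eq (hCp c₀ hc₀) (hAp x hx)⟩, fun c hc => hZ c (hC' c hc) x hx⟩
  have hcandAnd : candA.Nodup := shiftCands_nodup p Cl RZ
  have hAlmem : ∀ x, x ∈ Al ↔ x ∈ Av := by
    intro x; rw [hAl, List.mem_filter, decide_eq_true_eq]; exact ⟨fun h => h.2, fun h => ⟨hAsub x h, h⟩⟩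
  have hAlnd : Al.Nodup := hcandAnd.filter _
  have hAllen : Al.length = #Av := by rw [hAl, length_filter_mem_of_subset hcandAnd hAsub]
  have hn2 : (diffList p Cl Al).Nodup := nodup_diffList hClnd hAlnd fun c₁ hc₁ c₂ hc₂ x₁ hx₁ x₂ hx₂ h =>
    hinjZ c₁ ((hClmem _).1 hc₁) c₂ ((hClmem _).1 hc₂) x₁ ((hAlmem _).1 hx₁) x₂ ((hAlmem _).1 hx₂) h
  have hn3 : (diffList p Al (0 :: Bl)).Nodup := nodup_diffList hAlnd hB0nd fun c₁ hc₁ c₂ hc₂ x₁ hx₁ x₂ hx₂ h =>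
    hinjX c₁ ((hAlmem _).1 hc₁) c₂ ((hAlmem _).1 hc₂) x₁ ((hB0l _).1 hx₁) x₂ ((hB0l _).1 hx₂) h
  exact ⟨Al, hAlnd, hAlmem, List.mem_sublistsLen.2 ⟨by rw [hAl]; exact List.filter_sublist, hAllen⟩, hn2, hn3⟩

end Realise

/-! ## §4 Values of progression points -/

section Values

variable {p : ℕ} [hp : Fact p.Prime]

/-- `(u·((y₀ + t•d) − y₀)).val = ((u d).val · t) mod p`. [folklore] -/
theorem val_mul_nsmul_sub (u y₀ d : ZMod p) (t : ℕ) : (u * (y₀ + t • d - y₀)).val = ((u * d).val * t) % p := by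
  have : u * (y₀ + t • d - y₀) = 0 + t • (u * d) := by rw [nsmul_eq_mul, nsmul_eq_mul]; ring
  rw [this, val_add_nsmul_zmod, ZMod.val_zero, zero_add]

/-- `(u·((c + t•d) − y₀)).val = ((u(c − y₀)).val + (u d).val · t) mod p`. [folklore] -/
theorem val_mul_add_nsmul_sub (u c y₀ d : ZMod p) (t : ℕ) :
    (u * (c + t • d - y₀)).val = ((u * (c - y₀)).val + (u * d).val * t) % p := by
  have : u * (c + t • d - y₀) = u * (c - y₀) + t • (u * d) := by rw [nsmul_eq_mul, nsmul_eq_mul]; ring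
  rw [this, val_add_nsmul_zmod]

/-- With `u e′ = 1`: `(u·((z₀ + t•e′) − z₀)).val = t` for `t < p`. [folklore] -/
theorem val_mul_nsmul_sub_of_mul_eq_one {u e' : ZMod p} (hue : u * e' = 1) (z₀ : ZMod p) {t : ℕ} (ht : t < p) :
    (u * (z₀ + t • e' - z₀)).val = t := by
  have : u * (z₀ + t • e' - z₀) = (t : ZMod p) := by rw [nsmul_eq_mul]; linear_combination (t : ZMod p) * hue
  rw [this, ZMod.val_natCast, Nat.mod_eq_of_lt ht]

/-- **Y-values from an index description.**  If every point of `Yo` is `y₀ + t•d` for some `t` of the list `TL` and every `t ∈ TL` gives a point of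
`Yo`, then the `u`-values of `Yo` relative to `y₀` are exactly the members of `TL.map (t ↦ ((u d).val·t) mod p)`. [folklore] -/
theorem vals_of_indices (u y₀ d : ZMod p) (TL : List ℕ) (Yo : Finset (ZMod p))
    (h1 : ∀ x ∈ Yo, ∃ t ∈ TL, x = y₀ + t • d) (h2 : ∀ t ∈ TL, y₀ + t • d ∈ Yo) :
    (∀ x ∈ Yo, (u * (x - y₀)).val ∈ TL.map fun t => ((u * d).val * t) % p) ∧
      ∀ t' ∈ TL.map (fun t => ((u * d).val * t) % p), ∃ x ∈ Yo, (u * (x - y₀)).val = t' := by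
  constructor
  · intro x hx
    obtain ⟨t, ht, rfl⟩ := h1 x hx
    exact List.mem_map.2 ⟨t, ht, (val_mul_nsmul_sub u y₀ d t).symm⟩
  · intro t' ht'
    obtain ⟨t, ht, rfl⟩ := List.mem_map.1 ht'
    exact ⟨y₀ + t • d, h2 t ht, val_mul_nsmul_sub u y₀ d t⟩

/-- **Z-values from an index description** (the step `e′` with `u e′ = 1`, indices below `p`): the `u`-values of `Zo` relative to `z₀` are exactly the
members of `TL`. [folklore] -/
theorem vals_of_indices_one {u e' : ZMod p} (hue : u * e' = 1) (z₀ : ZMod p) (TL : List ℕ) (hTL : ∀ t ∈ TL, t < p) (Zo : Finset (ZMod p))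
    (h1 : ∀ x ∈ Zo, ∃ t ∈ TL, x = z₀ + t • e') (h2 : ∀ t ∈ TL, z₀ + t • e' ∈ Zo) :
    (∀ x ∈ Zo, (u * (x - z₀)).val ∈ TL) ∧ ∀ t ∈ TL, ∃ x ∈ Zo, (u * (x - z₀)).val = t := by
  constructor
  · intro x hx
    obtain ⟨t, ht, rfl⟩ := h1 x hx
    rwa [val_mul_nsmul_sub_of_mul_eq_one hue z₀ (hTL t ht)]
  · intro t ht
    exact ⟨z₀ + t • e', h2 t ht, val_mul_nsmul_sub_of_mul_eq_one hue z₀ (hTL t ht)⟩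

end Values

end Summit.MatrixMultiplication.OmegaCensus.CubeNB
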